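import Mathlib
import HarnessLib

/-!
# `BetaCancellation` (stmt-KontsevichZagierPeriods-13633) — line `dirichlet-companion-to-pi`,
stub `stub_eulerTrigSum`

The trigonometric bookkeeping in the assembly of Euler's reflection formula
`B(p/q, 1 − p/q) · sin(πp/q) = π` inside the Kontsevich–Zagier calculus (item
stmt-KontsevichZagierPeriods-3383): term `j` of the partial-fraction expansion contributes
`q − 2j − 1` unit pieces of weight `c_j = 4 sin(πp/q) sin(p(2j+1)π/q)`, and the weights total `2q`.
With `A = πp/q`, `0 < p < q` and `J = ⌊q/2⌋` (natural-number division):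

  `Σ_{j<J} (q − 2j − 1) · 4 sin A · sin((2j+1)A) = 2q`.

Elementary proof (all real, no division inside the calculus). Put `C_j = cos(2jA)`.
* Product-to-sum: `4 sin A sin((2j+1)A) = 2 (C_j − C_{j+1})` (`eulerTrigSum_weight`).
* Abel summation with the weights `a_j = q − 2j − 1` (`a_j − a_{j+1} = 2`), valid for every
  sequence `C`: `Σ_{j<J} a_j (C_j − C_{j+1}) = (q+1) C_0 − a_J C_J − 2 Σ_{j≤J} C_j`
  (`eulerTrigSum_abel`, induction on `J`).
* Lagrange's identity in telescoped form: `2 sin A · Σ_{j≤J} cos(2jA) = sin((2J+1)A) + sin A`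
  (`eulerTrigSum_lagrange`, induction on `J` with `2 sin A cos B = sin(A − B) + sin(A + B)`).
* Parity split `q = 2J` (then `a_J = −1`, `2JA = πp`, `sin((2J+1)A) = cos(πp) sin A`) resp.
  `q = 2J + 1` (then `a_J = 0`, `sin((2J+1)A) = sin(πp) = 0`): in both cases
  `a_J sin A · C_J + sin((2J+1)A) = 0`, whence `sin A · (1 − a_J C_J − 2 Σ_{j≤J} C_j) = 0`;
  as `0 < A < π` gives `sin A > 0`, the bracket vanishes and the sum is
  `2 ((q+1) − a_J C_J − 2 Σ_{j≤J} C_j) = 2q`.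

No definitions are introduced; the file is a pure proof file over Mathlib.
-/

-- `Summit.KontsevichZagierPeriods.KontsevichZagierPeriods.…` is the tree's mandated layout (single-conjunct summit).
set_option linter.dupNamespace false

namespace Summit.KontsevichZagierPeriods.KontsevichZagierPeriods.BetaCancellationLine

/-! ## Three elementary identities -/

/-- **Abel summation** with the arithmetic weights `a_j = q − 2j − 1`: for every real sequence `C`
and every `J`,
`Σ_{j<J} (q − 2j − 1) (C_j − C_{j+1}) = (q+1) C_0 − (q − 2J − 1) C_J − 2 Σ_{j≤J} C_j`
(induction on `J`; the step is `a_J − a_{J+1} = 2`). [folklore] -/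
theorem eulerTrigSum_abel (q : ℝ) (C : ℕ → ℝ) (J : ℕ) :
    ∑ j ∈ Finset.range J, (q - 2 * j - 1) * (C j - C (j + 1)) =
      (q + 1) * C 0 - (q - 2 * J - 1) * C J - 2 * ∑ j ∈ Finset.range (J + 1), C j := by
  induction J with
  | zero =>
    simp only [zero_add, Finset.sum_range_zero, Finset.sum_range_one, Nat.cast_zero]
    ring
  | succ J ih =>
    simp only [Finset.sum_range_succ] at ih ⊢
    rw [ih]
    push_cast
    ring

/-- **Lagrange's trigonometric identity** (telescoped form): for real `A` and every `J`,
`2 sin A · Σ_{j≤J} cos(2jA) = sin((2J+1)A) + sin A`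
(induction on `J`, using `2 sin A cos(2(J+1)A) = sin((2J+3)A) − sin((2J+1)A)`). [folklore] -/
theorem eulerTrigSum_lagrange (A : ℝ) (J : ℕ) :
    2 * Real.sin A * ∑ j ∈ Finset.range (J + 1), Real.cos (2 * j * A) =
      Real.sin ((2 * J + 1) * A) + Real.sin A := by
  induction J with
  | zero =>
    simp only [zero_add, Finset.sum_range_one, Nat.cast_zero, mul_zero, zero_mul, Real.cos_zero,
      mul_one, one_mul]
    ring
  | succ J ih =>
    rw [Finset.sum_range_succ, mul_add, ih]
    have h := Real.two_mul_sin_mul_cos A (2 * ((J:ℝ) + 1) * A)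
    have h1 : A - 2 * ((J:ℝ) + 1) * A = -((2 * J + 1) * A) := by ring
    have h2 : A + 2 * ((J:ℝ) + 1) * A = (2 * ((J:ℝ) + 1) + 1) * A := by ring
    rw [h1, h2, Real.sin_neg] at h
    push_cast
    linear_combination h

/-- **Product-to-sum** for the weights: `4 sin A sin((2j+1)A) = 2 (cos(2jA) − cos(2(j+1)A))`
(from `2 sin x sin y = cos(x − y) − cos(x + y)`). [folklore] -/
theorem eulerTrigSum_weight (A : ℝ) (j : ℕ) :
    4 * Real.sin A * Real.sin ((2 * j + 1) * A) =
      2 * (Real.cos (2 * j * A) - Real.cos (2 * ((j + 1 : ℕ) : ℝ) * A)) := by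
  have h := Real.two_mul_sin_mul_sin ((2 * j + 1) * A) A
  have h1 : (2 * (j:ℝ) + 1) * A - A = 2 * j * A := by ring
  have h2 : (2 * (j:ℝ) + 1) * A + A = 2 * ((j + 1 : ℕ) : ℝ) * A := by push_cast; ring
  rw [h1, h2] at h
  linear_combination 2 * h

/-! ## The stub -/

/-- **Trigonometric bookkeeping of Euler reflection** (stub `stub_eulerTrigSum` of the line
`dirichlet-companion-to-pi`): for natural numbers `0 < p < q`,
`Σ_{j < ⌊q/2⌋} (q − 2j − 1) · 4 sin(πp/q) sin(π(2j+1)p/q) = 2q`.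
Proof: product-to-sum, Abel summation, Lagrange's identity and the parity split `q = 2J` /
`q = 2J+1` (module docstring); the only non-degeneracy used is `sin(πp/q) > 0`. [folklore] -/
theorem stub_eulerTrigSum : ∀ (p q : ℕ), 0 < p → p < q → ∑ j ∈ Finset.range (q / 2), ((q:ℝ) - 2 * j - 1) * (4 * Real.sin (Real.pi * p / q) * Real.sin (Real.pi * (2 * j + 1) * p / q)) = 2 * q := by
  intro p q hp hpq
  set A : ℝ := Real.pi * p / q with hA
  have hq0 : (q:ℝ) ≠ 0 := by exact_mod_cast (show q ≠ 0 by omega)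
  have hqA : (q:ℝ) * A = Real.pi * p := by
    rw [hA]
    field_simp
  -- Step 1: product-to-sum termwise, then Abel summation.
  have h1 : ∀ j ∈ Finset.range (q / 2), ((q:ℝ) - 2 * j - 1) *
      (4 * Real.sin A * Real.sin (Real.pi * (2 * j + 1) * p / q)) =
        2 * (((q:ℝ) - 2 * j - 1) * (Real.cos (2 * j * A) - Real.cos (2 * ((j + 1 : ℕ) : ℝ) * A))) := by
    intro j _
    have harg : Real.pi * (2 * j + 1) * p / q = (2 * j + 1) * A := by
      rw [hA]
      ring
    rw [harg, eulerTrigSum_weight]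
    ring
  rw [Finset.sum_congr rfl h1, ← Finset.mul_sum, eulerTrigSum_abel]
  set J : ℕ := q / 2 with hJ
  -- Step 2: `sin A > 0`.
  have hsinA : 0 < Real.sin A := by
    apply Real.sin_pos_of_pos_of_lt_pi
    · rw [hA]
      exact div_pos (mul_pos Real.pi_pos (by exact_mod_cast hp))
        (by exact_mod_cast (show 0 < q by omega))
    · rw [hA, div_lt_iff₀ (by exact_mod_cast (show 0 < q by omega) : (0:ℝ) < q)]
      exact mul_lt_mul_of_pos_left (by exact_mod_cast hpq) Real.pi_pos
  -- Step 3: the parity fact `a_J sin A cos(2JA) + sin((2J+1)A) = 0`.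
  have hkey : ((q:ℝ) - 2 * J - 1) * Real.sin A * Real.cos (2 * J * A) +
      Real.sin ((2 * J + 1) * A) = 0 := by
    have hsinp : Real.sin (Real.pi * p) = 0 := by
      rw [mul_comm]
      exact Real.sin_nat_mul_pi p
    rcases Nat.even_or_odd' q with ⟨k, hk | hk⟩
    · -- `q = 2k`, `J = k`, `a_J = -1`, `2JA = πp`.
      have hJk : J = k := by omega
      have hqR : (q:ℝ) = 2 * k := by exact_mod_cast hk
      have h2JA : 2 * (J:ℝ) * A = Real.pi * p := by
        rw [hJk, ← hqR]
        exact hqA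
      have hS : Real.sin ((2 * J + 1) * A) = Real.cos (Real.pi * p) * Real.sin A := by
        have e : (2 * (J:ℝ) + 1) * A = 2 * J * A + A := by ring
        rw [e, Real.sin_add, h2JA, hsinp]
        ring
      rw [hS, h2JA, hqR, hJk]
      ring
    · -- `q = 2k+1`, `J = k`, `a_J = 0`, `(2J+1)A = πp`.
      have hJk : J = k := by omega
      have hqR : (q:ℝ) = 2 * k + 1 := by exact_mod_cast hk
      have h2JA : (2 * (J:ℝ) + 1) * A = Real.pi * p := by
        rw [hJk, ← hqR]
        exact hqA
      have hS : Real.sin ((2 * J + 1) * A) = 0 := by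
        rw [h2JA, hsinp]
      rw [hS, hqR, hJk]
      ring
  -- Step 4: the bracket vanishes, by Lagrange's identity and `sin A ≠ 0`.
  have hlag := eulerTrigSum_lagrange A J
  have hX : Real.sin A * (1 - ((q:ℝ) - 2 * J - 1) * Real.cos (2 * J * A) -
      2 * ∑ j ∈ Finset.range (J + 1), Real.cos (2 * j * A)) = 0 := by
    linear_combination (-1 : ℝ) * hkey - hlag
  have hX' : 1 - ((q:ℝ) - 2 * J - 1) * Real.cos (2 * J * A) -
      2 * ∑ j ∈ Finset.range (J + 1), Real.cos (2 * j * A) = 0 :=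
    (mul_eq_zero.1 hX).resolve_left hsinA.ne'
  have hC0 : Real.cos (2 * ((0 : ℕ) : ℝ) * A) = 1 := by simp
  rw [hC0]
  linear_combination 2 * hX'

end Summit.KontsevichZagierPeriods.KontsevichZagierPeriods.BetaCancellationLine
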